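import Literature.MathematicalPhysics.QuantumLattice.KroneckerTraceSchwarz
import HarnessLib

/-!
# The Dyson–Lieb–Simon trace inequality on invariant sectors

[DLS1978] Lemma 4.1 (eq. (45); [LSSY2005] Ch. 11 (11.17)–(11.19)) is stated for operators on a
Hilbert space `ℋ ⊗ ℋ'`; applied to the RESTRICTIONS of real matrices `A, Mᵢ` (size `m`) and
`B, Nᵢ` (size `n`) to invariant subspaces `Ran P ⊆ ℂ^m`, `Ran Q ⊆ ℂ^n` (`P`, `Q` real idempotents
commuting with `A, Mᵢ` resp. `B, Nᵢ`; the restricted operators are again real and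
`Ran P ⊗ Ran Q` is invariant under `K = A⊗1 + 1⊗B + Σᵢ Mᵢ⊗Nᵢ`) it reads, written with the
projections instead of the subspaces,

  `Re Tr[(P⊗Q) exp(A⊗1 + 1⊗B + Σᵢ Mᵢ⊗Nᵢ)]
      ≤ (Re Tr[(P⊗P) exp(A⊗1 + 1⊗A + Σᵢ Mᵢ⊗Mᵢ)])^{1/2} (Re Tr[(Q⊗Q) exp(B⊗1 + 1⊗B + Σᵢ Nᵢ⊗Nᵢ)])^{1/2}`

(`trace_kronecker_mul_exp_kroneckerSum_le`; `P = 1`, `Q = 1` is the tree's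
`Matrix.trace_exp_kroneckerSum_le`). This is the form in which Gaussian-domination arguments of
DLS type descend from the full (Fock) space to symmetry sectors — e.g. from the grand-canonical to
the canonical `(N↑, N↓) = (m, m)` Gibbs states of a lattice fermion model whose hopping and
interaction conserve both particle numbers (the sector projections are real, diagonal in the
occupation basis, and commute with every Trotter factor).

Proof (no new analysis): for the Euler approximants `Xₐ ∈ {1 + A/N} ∪ {N^{-1/2}Mᵢ}`,
`Yₐ ∈ {1 + B/N} ∪ {N^{-1/2}Nᵢ}` of `KroneckerTraceSchwarz.lean` one has, for `N ≥ 1`,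
`(P⊗Q)(Σₐ Xₐ⊗Yₐ)^N = (Σₐ (PXₐ)⊗(QYₐ))^N` (`P⊗Q` is an idempotent commuting with every `Xₐ⊗Yₐ`),
the matrices `PXₐ`, `QYₐ` are real, so the word-level Schwarz inequality
`Matrix.trace_pow_kroneckerSum_le` applies to the projected families; then `N → ∞` with
`Matrix.tendsto_approximant_pow` exactly as in the unprojected case.

References: [DLS1978] F. J. Dyson, E. H. Lieb, B. Simon, J. Stat. Phys. 18 (1978) 335–383,
Lemma 4.1; [LSSY2005] E. H. Lieb, R. Seiringer, J. P. Solovej, J. Yngvason, *The Mathematics of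
the Bose Gas and its Condensation* (2005), Ch. 11 (11.14)–(11.19).
-/

noncomputable section

open NormedSpace Filter Topology Finset Matrix
open scoped Kronecker

namespace Literature.MathematicalPhysics.QuantumLattice

variable {m n : Type*} [Fintype m] [Fintype n] [DecidableEq m] [DecidableEq n]

/-- Products of real matrices are real (`Xᵀ = Xᴴ` form). [folklore] -/
private theorem transpose_eq_conjTranspose_mul_of_real {μ : Type*} [Fintype μ]
    {P X : Matrix μ μ ℂ} (hP : Pᵀ = Pᴴ) (hX : Xᵀ = Xᴴ) : (P * X)ᵀ = (P * X)ᴴ := by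
  rw [transpose_mul, conjTranspose_mul, hP, hX]

/-- Positive powers of an idempotent. [folklore] -/
private theorem pow_succ_eq_self_of_mul_self_eq {R : Type*} [Monoid R] {E : R} (hE : E * E = E) :
    ∀ k : ℕ, E ^ (k + 1) = E
  | 0 => pow_one E
  | k + 1 => by rw [pow_succ, pow_succ_eq_self_of_mul_self_eq hE k, hE]

/-- **Projecting a power of a separable sum**: if `P`, `Q` are idempotents commuting with every
`Xₐ` resp. `Yₐ`, then `(P⊗Q)(Σₐ Xₐ⊗Yₐ)^{k+1} = (Σₐ (PXₐ)⊗(QYₐ))^{k+1}`. [folklore] -/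
private theorem kronecker_mul_pow_kroneckerSum_eq {C : Type*} [Fintype C] (X : C → Matrix m m ℂ)
    (Y : C → Matrix n n ℂ) {P : Matrix m m ℂ} {Q : Matrix n n ℂ} (hPP : P * P = P)
    (hQQ : Q * Q = Q) (hPX : ∀ a, Commute P (X a)) (hQY : ∀ a, Commute Q (Y a)) (k : ℕ) :
    P ⊗ₖ Q * (∑ a, X a ⊗ₖ Y a) ^ (k + 1) = (∑ a, (P * X a) ⊗ₖ (Q * Y a)) ^ (k + 1) := by
  have hE : P ⊗ₖ Q * P ⊗ₖ Q = P ⊗ₖ Q := by rw [← mul_kronecker_mul, hPP, hQQ]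
  have hES : Commute (P ⊗ₖ Q) (∑ a, X a ⊗ₖ Y a) := by
    refine Commute.sum_right _ _ _ fun a _ => ?_
    show P ⊗ₖ Q * X a ⊗ₖ Y a = X a ⊗ₖ Y a * P ⊗ₖ Q
    rw [← mul_kronecker_mul, ← mul_kronecker_mul, (hPX a).eq, (hQY a).eq]
  have hsum : ∑ a, (P * X a) ⊗ₖ (Q * Y a) = P ⊗ₖ Q * ∑ a, X a ⊗ₖ Y a := by
    rw [Finset.mul_sum]
    exact sum_congr rfl fun a _ => mul_kronecker_mul P (X a) Q (Y a)
  rw [hsum, hES.mul_pow, pow_succ_eq_self_of_mul_self_eq hE]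

/-- **Projected trace Schwarz inequality for powers of separable sums** ([DLS1978] Lemma 4.1,
eq. (47), on the invariant subspaces `Ran P ⊗ Ran Q`): for REAL families `Xₐ` (size `m`), `Yₐ`
(size `n`), REAL idempotents `P`, `Q` commuting with every `Xₐ` resp. `Yₐ`, and `N = k + 1 ≥ 1`,
`Re Tr[(P⊗Q)(Σₐ Xₐ⊗Yₐ)^N] ≤ (Re Tr[(P⊗P)(Σₐ Xₐ⊗Xₐ)^N])^{1/2} (Re Tr[(Q⊗Q)(Σₐ Yₐ⊗Yₐ)^N])^{1/2}`
— `Matrix.trace_pow_kroneckerSum_le` for the projected (still real) families `PXₐ`, `QYₐ`.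
[cite: DLS1978, Lemma 4.1, eq. (47)] [cite: LSSY2005, Ch. 11 (11.6)–(11.7)] -/
theorem trace_kronecker_mul_pow_kroneckerSum_le {C : Type*} [Fintype C]
    {X : C → Matrix m m ℂ} {Y : C → Matrix n n ℂ} (hX : ∀ a, (X a)ᵀ = (X a)ᴴ)
    (hY : ∀ a, (Y a)ᵀ = (Y a)ᴴ) {P : Matrix m m ℂ} {Q : Matrix n n ℂ} (hP : Pᵀ = Pᴴ)
    (hQ : Qᵀ = Qᴴ) (hPP : P * P = P) (hQQ : Q * Q = Q) (hPX : ∀ a, Commute P (X a))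
    (hQY : ∀ a, Commute Q (Y a)) (k : ℕ) :
    ((P ⊗ₖ Q * (∑ a, X a ⊗ₖ Y a) ^ (k + 1)).trace).re ≤
      Real.sqrt ((P ⊗ₖ P * (∑ a, X a ⊗ₖ X a) ^ (k + 1)).trace).re *
        Real.sqrt ((Q ⊗ₖ Q * (∑ a, Y a ⊗ₖ Y a) ^ (k + 1)).trace).re := by
  rw [kronecker_mul_pow_kroneckerSum_eq X Y hPP hQQ hPX hQY,
    kronecker_mul_pow_kroneckerSum_eq X X hPP hPP hPX hPX,
    kronecker_mul_pow_kroneckerSum_eq Y Y hQQ hQQ hQY hQY]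
  exact trace_pow_kroneckerSum_le (fun a => transpose_eq_conjTranspose_mul_of_real hP (hX a))
    (fun a => transpose_eq_conjTranspose_mul_of_real hQ (hY a)) (k + 1)

variable [Nonempty m] [Nonempty n]

/-- **The Dyson–Lieb–Simon trace inequality on invariant sectors** ([DLS1978] Lemma 4.1,
eq. (45), applied to the restrictions of the operators to `Ran P ⊗ Ran Q`; [LSSY2005] Ch. 11
(11.17)–(11.19)): for REAL square matrices `A, Mᵢ` (size `m`), `B, Nᵢ` (size `n`) and REAL
idempotents `P` (commuting with `A` and every `Mᵢ`) and `Q` (commuting with `B` and every `Nᵢ`),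
`Re Tr[(P⊗Q) exp(A⊗1 + 1⊗B + ΣᵢMᵢ⊗Nᵢ)] ≤
  (Re Tr[(P⊗P) exp(A⊗1 + 1⊗A + ΣᵢMᵢ⊗Mᵢ)])^{1/2} (Re Tr[(Q⊗Q) exp(B⊗1 + 1⊗B + ΣᵢNᵢ⊗Nᵢ)])^{1/2}`.
With `P = 1`, `Q = 1` this is `Matrix.trace_exp_kroneckerSum_le`. Proof:
`trace_kronecker_mul_pow_kroneckerSum_le` for the Euler approximants and the product formula
`Matrix.tendsto_approximant_pow`. [cite: DLS1978, Lemma 4.1] [cite: LSSY2005, Ch. 11 (11.17)–(11.19)] -/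
theorem trace_kronecker_mul_exp_kroneckerSum_le {ι : Type*} [Fintype ι] {A : Matrix m m ℂ}
    {B : Matrix n n ℂ} {M : ι → Matrix m m ℂ} {Nn : ι → Matrix n n ℂ} (hA : Aᵀ = Aᴴ)
    (hB : Bᵀ = Bᴴ) (hM : ∀ i, (M i)ᵀ = (M i)ᴴ) (hN : ∀ i, (Nn i)ᵀ = (Nn i)ᴴ)
    {P : Matrix m m ℂ} {Q : Matrix n n ℂ} (hP : Pᵀ = Pᴴ) (hQ : Qᵀ = Qᴴ) (hPP : P * P = P)
    (hQQ : Q * Q = Q) (hPA : Commute P A) (hPM : ∀ i, Commute P (M i)) (hQB : Commute Q B)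
    (hQN : ∀ i, Commute Q (Nn i)) :
    ((P ⊗ₖ Q * exp (A ⊗ₖ (1 : Matrix n n ℂ) + (1 : Matrix m m ℂ) ⊗ₖ B + ∑ i, M i ⊗ₖ Nn i)).trace).re ≤
      Real.sqrt ((P ⊗ₖ P * exp (A ⊗ₖ (1 : Matrix m m ℂ) + (1 : Matrix m m ℂ) ⊗ₖ A +
          ∑ i, M i ⊗ₖ M i)).trace).re *
        Real.sqrt ((Q ⊗ₖ Q * exp (B ⊗ₖ (1 : Matrix n n ℂ) + (1 : Matrix n n ℂ) ⊗ₖ B +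
          ∑ i, Nn i ⊗ₖ Nn i)).trace).re := by
  -- the approximating families (as in `Matrix.trace_exp_kroneckerSum_le`)
  set X : ℕ → Option ι → Matrix m m ℂ := fun N a =>
    Option.elim a ((1 : Matrix m m ℂ) + ((N : ℂ))⁻¹ • A) (fun i => (((Real.sqrt N)⁻¹ : ℝ) : ℂ) • M i)
    with hXdef
  set Y : ℕ → Option ι → Matrix n n ℂ := fun N a =>
    Option.elim a ((1 : Matrix n n ℂ) + ((N : ℂ))⁻¹ • B) (fun i => (((Real.sqrt N)⁻¹ : ℝ) : ℂ) • Nn i)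
    with hYdef
  -- reality
  have hX : ∀ N a, (X N a)ᵀ = (X N a)ᴴ := by
    intro N a
    rcases a with _ | i
    · exact transpose_eq_conjTranspose_one_add_inv_smul hA N
    · exact transpose_eq_conjTranspose_ofReal_smul' (hM i) _
  have hY : ∀ N a, (Y N a)ᵀ = (Y N a)ᴴ := by
    intro N a
    rcases a with _ | i
    · exact transpose_eq_conjTranspose_one_add_inv_smul hB N
    · exact transpose_eq_conjTranspose_ofReal_smul' (hN i) _
  -- commutation with the projections
  have hPX : ∀ N a, Commute P (X N a) := by
    intro N a
    rcases a with _ | i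
    · exact (Commute.one_right P).add_right (hPA.smul_right _)
    · exact (hPM i).smul_right _
  have hQY : ∀ N a, Commute Q (Y N a) := by
    intro N a
    rcases a with _ | i
    · exact (Commute.one_right Q).add_right (hQB.smul_right _)
    · exact (hQN i).smul_right _
  -- the inequality for every `N ≥ 1`
  have hineq : ∀ᶠ N : ℕ in atTop, ((P ⊗ₖ Q * (∑ a, X N a ⊗ₖ Y N a) ^ N).trace).re ≤
      Real.sqrt ((P ⊗ₖ P * (∑ a, X N a ⊗ₖ X N a) ^ N).trace).re *
        Real.sqrt ((Q ⊗ₖ Q * (∑ a, Y N a ⊗ₖ Y N a) ^ N).trace).re := by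
    refine Filter.eventually_atTop.2 ⟨1, fun N hN1 => ?_⟩
    obtain ⟨k, rfl⟩ := Nat.exists_eq_add_of_le' hN1
    exact trace_kronecker_mul_pow_kroneckerSum_le (hX (k + 1)) (hY (k + 1)) hP hQ hPP hQQ
      (hPX (k + 1)) (hQY (k + 1)) k
  -- the three limits
  have hXY : Tendsto (fun N : ℕ => ((P ⊗ₖ Q * (∑ a, X N a ⊗ₖ Y N a) ^ N).trace).re) atTop
      (𝓝 ((P ⊗ₖ Q * exp (A ⊗ₖ (1 : Matrix n n ℂ) + (1 : Matrix m m ℂ) ⊗ₖ B +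
        ∑ i, M i ⊗ₖ Nn i)).trace).re) := by
    have h := ((LinearMap.mulLeft ℂ (P ⊗ₖ Q)).continuous_of_finiteDimensional.tendsto _).comp
      (tendsto_approximant_pow A B M Nn)
    have h2 := (Complex.continuous_re.tendsto _).comp
      (((Matrix.traceLinearMap (m × n) ℂ ℂ).continuous_of_finiteDimensional.tendsto _).comp h)
    refine h2.congr fun N => ?_
    simp only [Function.comp_apply, Matrix.traceLinearMap_apply, LinearMap.mulLeft_apply, hXdef,
      hYdef, sum_option_kronecker_approximant]
  have hXX : Tendsto (fun N : ℕ => Real.sqrt ((P ⊗ₖ P * (∑ a, X N a ⊗ₖ X N a) ^ N).trace).re)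
      atTop (𝓝 (Real.sqrt ((P ⊗ₖ P * exp (A ⊗ₖ (1 : Matrix m m ℂ) + (1 : Matrix m m ℂ) ⊗ₖ A +
        ∑ i, M i ⊗ₖ M i)).trace).re)) := by
    have h := ((LinearMap.mulLeft ℂ (P ⊗ₖ P)).continuous_of_finiteDimensional.tendsto _).comp
      (tendsto_approximant_pow A A M M)
    have h2 := ((Real.continuous_sqrt.comp Complex.continuous_re).tendsto _).comp
      (((Matrix.traceLinearMap (m × m) ℂ ℂ).continuous_of_finiteDimensional.tendsto _).comp h)
    refine h2.congr fun N => ?_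
    simp only [Function.comp_apply, Matrix.traceLinearMap_apply, LinearMap.mulLeft_apply, hXdef,
      sum_option_kronecker_approximant]
  have hYY : Tendsto (fun N : ℕ => Real.sqrt ((Q ⊗ₖ Q * (∑ a, Y N a ⊗ₖ Y N a) ^ N).trace).re)
      atTop (𝓝 (Real.sqrt ((Q ⊗ₖ Q * exp (B ⊗ₖ (1 : Matrix n n ℂ) + (1 : Matrix n n ℂ) ⊗ₖ B +
        ∑ i, Nn i ⊗ₖ Nn i)).trace).re)) := by
    have h := ((LinearMap.mulLeft ℂ (Q ⊗ₖ Q)).continuous_of_finiteDimensional.tendsto _).comp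
      (tendsto_approximant_pow B B Nn Nn)
    have h2 := ((Real.continuous_sqrt.comp Complex.continuous_re).tendsto _).comp
      (((Matrix.traceLinearMap (n × n) ℂ ℂ).continuous_of_finiteDimensional.tendsto _).comp h)
    refine h2.congr fun N => ?_
    simp only [Function.comp_apply, Matrix.traceLinearMap_apply, LinearMap.mulLeft_apply, hYdef,
      sum_option_kronecker_approximant]
  exact le_of_tendsto_of_tendsto hXY (hXX.mul hYY) hineq

end Literature.MathematicalPhysics.QuantumLattice

end
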